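import Literature.NumberTheory.FaltingsSerre.ConjCertificate
import Literature.NumberTheory.FaltingsSerre.ResidualRigidity
import Literature.NumberTheory.FaltingsSerre.ResidualRigidityS3wrS2
import Literature.NumberTheory.FaltingsSerre.ResidualSymplectic
import Literature.NumberTheory.FaltingsSerre.CertificateConjTransfer
import HarnessLib

/-!
# Step 1 of a `ConjCertificate` from residual data: Route T (`S₅(b)`), `S₆`, `S₃ ≀ S₂`

[BPPTVY] = A. Brumer, A. Pacetti, C. Poor, G. Tornaría, J. Voight, D. S. Yuen, *On the paramodularity of
typical abelian surfaces*, Algebra & Number Theory **13**:5 (2019) 1145–1195 [cite: BrumerEtAl2019].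

The Step 1 field of the schema variant `ConjCertificate S P ν ρ₁ ρ₂` (`ConjCertificate.lean`) is
`residual_conj : ∃ π ∈ S₆, ∀ σ, ρ̄₂(σ) = ι(π) ρ̄₁(σ) ι(π)⁻¹`.  This file derives it from the data a
certificate producer actually has, by composing the residual-rigidity theorems of
`ResidualRigidity.lean` / `ResidualRigidityS3wrS2.lean` with `GSp4F2.range_residual_le_iotaGL_framed`
(`ResidualSymplectic.lean`: the residual image of a `GSp(J)`-valued representation lies in
`ι(S₆) = Sp₄(𝔽₂)` — so the "symplectic residual image" hypotheses come for free from the schema's own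
similitude fields):
* `ConjCertificate.residual_conj_of_transvection` — ROUTE T for image `S₅(b)` ([BPPTVY, §7.1–7.2],
  levels `277`, `349`): same `2`-division field (`ker ρ̄₁ = ker ρ̄₂`), an element of order `5` in the
  image, and one element acting as a transvection on both sides;
* `ConjCertificate.residual_conj_of_trace_orderThree` — image `S₆` ([BPPTVY, §7.3], `N = 587`): `ρ̄₁`
  onto `Sp₄(𝔽₂)`, same kernel field, and equal traces at one element of order `3`;
* `ConjCertificate.residual_conj_of_range_S3wrS2` — image `S₃ ≀ S₂` ([BPPTVY, §7.2], `N = 353`):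
  `ρ̄₁` with image a conjugate of `ι(S₃ ≀ S₂)`, same kernel field, equal traces at one element of order
  `3` or `6`;
and the corresponding constructors `ConjCertificate.ofTransvection` / `.ofTraceOrderThree[']` /
`.ofRangeS3wrS2` (all other fields passed through; the primed `S₆` constructor takes surjectivity as the
count `#im ρ̄₁ = 720`, `GSp4F2.range_eq_iotaGL_of_card`).  Finally `ConjCertificate.ofResidualConj` /
`SurfaceConjCertificate.ofResidualConj` TRANSFER a certificate up to frame from `(ρ₁, ρ₂)` to a second pair
`(ρ₁', ρ₂')` with `ρ̄₁' = ι(π) ρ̄₁ ι(π)⁻¹` (two surfaces with the same `2`-division field, each in its own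
frame, [BPPTVY, §7.3 p. 1191]: `C₅₈₇^±`), via `complete_of_conj` / `IsAbsIrreducible.of_conj` of
`CertificateConjTransfer.lean`.  No new cited fact.
-/

noncomputable section

namespace Literature.NumberTheory.FaltingsSerre

open Matrix Equiv Equiv.Perm Field IsDedekindDomain
open Literature.NumberTheory.GaloisRepresentations Literature.NumberTheory.FaltingsSerre.GSp4F2
open scoped NumberField

section Residual

variable {G : Type*} [Group G] [TopologicalSpace G] (ρ₁ ρ₂ : FramedRep G ℤ_[2] 4) (ν₁ ν₂ : G → ℤ_[2])

/-- **Route T** (image `S₅(b)`): from the similitude data, `ker ρ̄₁ = ker ρ̄₂`, an element `c` with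
`ρ̄₁(c)` of order `5`, and an element `i` with `ρ̄₁(i)`, `ρ̄₂(i)` transvections, the residual
representations are conjugate inside `ι(S₆)`. [cite: BrumerEtAl2019, §2.3 p. 1149, Lemma 5.1.5 p. 1174 and §7.1 p. 1187] -/
theorem ConjCertificate.residual_conj_of_transvection
    (hs₁ : ∀ σ, IsSimilitude (antiIdAlt4 ℤ_[2]) (ν₁ σ)
      ((ρ₁ σ : GL (Fin 4) ℤ_[2]) : Matrix (Fin 4) (Fin 4) ℤ_[2]))
    (hs₂ : ∀ σ, IsSimilitude (antiIdAlt4 ℤ_[2]) (ν₂ σ)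
      ((ρ₂ σ : GL (Fin 4) ℤ_[2]) : Matrix (Fin 4) (Fin 4) ℤ_[2]))
    (hker : ∀ γ, residual ρ₁.toMonoidHom γ = 1 ↔ residual ρ₂.toMonoidHom γ = 1)
    {c : G} (hc5 : residual ρ₁.toMonoidHom c ^ 5 = 1) (hc1 : residual ρ₁.toMonoidHom c ≠ 1)
    {i : G} (hi₁ : IsTransvection ((residual ρ₁.toMonoidHom i : GL (Fin 4) (ZMod 2)) :
      Matrix (Fin 4) (Fin 4) (ZMod 2)))
    (hi₂ : IsTransvection ((residual ρ₂.toMonoidHom i : GL (Fin 4) (ZMod 2)) :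
      Matrix (Fin 4) (Fin 4) (ZMod 2))) :
    ∃ π : Perm (Fin 6), ∀ γ,
      residual ρ₂.toMonoidHom γ = iotaGL π * residual ρ₁.toMonoidHom γ * (iotaGL π)⁻¹ :=
  exists_conj_of_ker_iff_of_transvection _ _ (range_residual_le_iotaGL_framed ρ₁ ν₁ hs₁)
    (range_residual_le_iotaGL_framed ρ₂ ν₂ hs₂) hker hc5 hc1 hi₁ hi₂

/-- **Image `S₆`**: `ρ̄₁` onto `ι(S₆) = Sp₄(𝔽₂)`, `ρ̄₂` symplectic (from its similitude data), same kernel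
field, and equal traces at one `u` with `ρ̄₁(u)` of order `3` ⇒ conjugate inside `ι(S₆)`. [cite: BrumerEtAl2019, §2.3 p. 1149, (5.1.8) p. 1174 and §7.3 p. 1191] -/
theorem ConjCertificate.residual_conj_of_trace_orderThree
    (h₁ : (residual ρ₁.toMonoidHom).range = iotaGL.range)
    (hs₂ : ∀ σ, IsSimilitude (antiIdAlt4 ℤ_[2]) (ν₂ σ)
      ((ρ₂ σ : GL (Fin 4) ℤ_[2]) : Matrix (Fin 4) (Fin 4) ℤ_[2]))
    (hker : ∀ γ, residual ρ₁.toMonoidHom γ = 1 ↔ residual ρ₂.toMonoidHom γ = 1)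
    {u : G} (hu3 : residual ρ₁.toMonoidHom u ^ 3 = 1) (hu1 : residual ρ₁.toMonoidHom u ≠ 1)
    (htr : Matrix.trace ((residual ρ₁.toMonoidHom u : GL (Fin 4) (ZMod 2)) :
        Matrix (Fin 4) (Fin 4) (ZMod 2)) =
      Matrix.trace ((residual ρ₂.toMonoidHom u : GL (Fin 4) (ZMod 2)) :
        Matrix (Fin 4) (Fin 4) (ZMod 2))) :
    ∃ π : Perm (Fin 6), ∀ γ,
      residual ρ₂.toMonoidHom γ = iotaGL π * residual ρ₁.toMonoidHom γ * (iotaGL π)⁻¹ :=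
  exists_conj_of_ker_iff_of_trace_orderThree _ _ h₁ (range_residual_le_iotaGL_framed ρ₂ ν₂ hs₂) hker
    hu3 hu1 htr

/-- **Image `S₃ ≀ S₂`** (`N = 353`): `ρ̄₁` with image a conjugate of `ι(S₃ ≀ S₂)`, `ρ̄₂` symplectic (from
its similitude data), same kernel field, equal traces at one `u` with `ρ̄₁(u)` of order `3` or `6` ⇒
conjugate inside `ι(S₆)`. [cite: BrumerEtAl2019, §2.3 p. 1149, (5.1.8) p. 1174 and §7.2 p. 1190] -/
theorem ConjCertificate.residual_conj_of_range_S3wrS2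
    (h₁ : ∃ g₁ : Perm (Fin 6), (residual ρ₁.toMonoidHom).range =
      ((Subgroup.closure (Set.range gensS3wrS2)).map (MulAut.conj g₁).toMonoidHom).map iotaGL)
    (hs₂ : ∀ σ, IsSimilitude (antiIdAlt4 ℤ_[2]) (ν₂ σ)
      ((ρ₂ σ : GL (Fin 4) ℤ_[2]) : Matrix (Fin 4) (Fin 4) ℤ_[2]))
    (hker : ∀ γ, residual ρ₁.toMonoidHom γ = 1 ↔ residual ρ₂.toMonoidHom γ = 1)
    {u : G} (hu6 : residual ρ₁.toMonoidHom u ^ 6 = 1) (hu2 : residual ρ₁.toMonoidHom u ^ 2 ≠ 1)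
    (htr : Matrix.trace ((residual ρ₁.toMonoidHom u : GL (Fin 4) (ZMod 2)) :
        Matrix (Fin 4) (Fin 4) (ZMod 2)) =
      Matrix.trace ((residual ρ₂.toMonoidHom u : GL (Fin 4) (ZMod 2)) :
        Matrix (Fin 4) (Fin 4) (ZMod 2))) :
    ∃ π : Perm (Fin 6), ∀ γ,
      residual ρ₂.toMonoidHom γ = iotaGL π * residual ρ₁.toMonoidHom γ * (iotaGL π)⁻¹ :=
  exists_conj_of_ker_iff_of_range_S3wrS2 _ _ h₁ (range_residual_le_iotaGL_framed ρ₂ ν₂ hs₂) hker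
    hu6 hu2 htr

/-- `#ι(S₆) = 720`. [cite: BrumerEtAl2019, (5.1.1)–(5.1.2) p. 1173] -/
theorem GSp4F2.card_range_iotaGL : Nat.card (iotaGL.range : Subgroup (GL (Fin 4) (ZMod 2))) = 720 := by
  rw [← Nat.card_congr iotaMulEquiv.toEquiv, Nat.card_eq_fintype_card, Fintype.card_perm,
    Fintype.card_fin]
  rfl

/-- **Image `S₆` from a count**: a residual image inside `ι(S₆)` of order `720` is all of `ι(S₆)` (the
form in which a certificate producer knows surjectivity: the `2`-division field has Galois group of
order `720`). [cite: BrumerEtAl2019, §5.1 p. 1173 and §7.3 p. 1191] -/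
theorem GSp4F2.range_eq_iotaGL_of_card {Γ : Type*} [Group Γ] (σ : Γ →* GL (Fin 4) (ZMod 2))
    (hSp : σ.range ≤ iotaGL.range) (h : Nat.card σ.range = 720) : σ.range = iotaGL.range :=
  Subgroup.eq_of_le_of_card_ge hSp (by rw [GSp4F2.card_range_iotaGL, h])

/-- The same for the residual representation of a `GSp(J)`-valued framed representation, the
symplectic hypothesis being discharged from the similitude data. [cite: BrumerEtAl2019, §2.1 p. 1150 and §5.1 p. 1173] -/
theorem GSp4F2.residual_range_eq_iotaGL_of_card
    (hs₁ : ∀ σ, IsSimilitude (antiIdAlt4 ℤ_[2]) (ν₁ σ)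
      ((ρ₁ σ : GL (Fin 4) ℤ_[2]) : Matrix (Fin 4) (Fin 4) ℤ_[2]))
    (h : Nat.card (residual ρ₁.toMonoidHom).range = 720) :
    (residual ρ₁.toMonoidHom).range = iotaGL.range :=
  GSp4F2.range_eq_iotaGL_of_card _ (range_residual_le_iotaGL_framed ρ₁ ν₁ hs₁) h

end Residual

section Constructors

variable {K : Type} [Field K] {S P : Set (HeightOneSpectrum (𝓞 K))}
  {ν : absoluteGaloisGroup K → ℤ_[2]} {ρ₁ ρ₂ : FramedGaloisRep K ℤ_[2] 4}

/-- The fields of `ConjCertificate` other than Step 1, bundled (so that the three constructors below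
share one signature). [cite: BrumerEtAl2019, Alg 2.4.1 Steps 2–5 p. 1156] -/
structure ConjCertificate.Rest (S P : Set (HeightOneSpectrum (𝓞 K)))
    (ν : absoluteGaloisGroup K → ℤ_[2]) (ρ₁ ρ₂ : FramedGaloisRep K ℤ_[2] 4) : Prop where
  /-- `ρ₁(σ)ᵀ J ρ₁(σ) = ν(σ) J`. -/
  similitude₁ : ∀ σ, IsSimilitude (antiIdAlt4 ℤ_[2]) (ν σ)
    ((ρ₁ σ : GL (Fin 4) ℤ_[2]) : Matrix (Fin 4) (Fin 4) ℤ_[2])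
  /-- `ρ₂(σ)ᵀ J ρ₂(σ) = ν(σ) J`. -/
  similitude₂ : ∀ σ, IsSimilitude (antiIdAlt4 ℤ_[2]) (ν σ)
    ((ρ₂ σ : GL (Fin 4) ℤ_[2]) : Matrix (Fin 4) (Fin 4) ℤ_[2])
  /-- `ρ̄₁` is absolutely irreducible. -/
  absIrreducible : IsAbsIrreducible (residual ρ₁.toMonoidHom)
  /-- `ρ₁` is unramified outside `S`. -/
  unramified₁ : ∀ v ∉ S, ρ₁.IsUnramifiedAt v
  /-- `ρ₂` is unramified outside `S`. -/
  unramified₂ : ∀ v ∉ S, ρ₂.IsUnramifiedAt v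
  /-- Steps 2–4 for `ρ̄₁`. -/
  complete : ∀ μ : absoluteGaloisGroup K → Matrix (Fin 4) (Fin 4) (ZMod 2), IsLocallyConstant μ →
    (∀ σ ∈ inertiaOutside K S, μ σ = 0) →
    ValuedIn (spLie ((antiIdAlt4 ℤ_[2]).map (PadicInt.toZMod (p := 2)))) μ →
    IsDeviationCocycle (residual ρ₁.toMonoidHom) μ → IsObstructing (residual ρ₁.toMonoidHom) μ →
    ∃ σ ∈ frobeniusAt K P, IsObstructingElt (residual ρ₁.toMonoidHom) μ σ
  /-- Step 5. -/
  traces : ∀ σ ∈ frobeniusAt K P, FramedRep.trace ρ₁ σ = FramedRep.trace ρ₂ σ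

/-- Assembling a `ConjCertificate` from `Rest` and any Step 1 witness. [cite: BrumerEtAl2019, Alg 2.4.1 p. 1156] -/
theorem ConjCertificate.ofRest (R : ConjCertificate.Rest S P ν ρ₁ ρ₂)
    (h : ∃ π : Perm (Fin 6), ∀ σ,
      residual ρ₂.toMonoidHom σ = iotaGL π * residual ρ₁.toMonoidHom σ * (iotaGL π)⁻¹) :
    ConjCertificate S P ν ρ₁ ρ₂ where
  similitude₁ := R.similitude₁
  similitude₂ := R.similitude₂
  residual_conj := h
  absIrreducible := R.absIrreducible
  unramified₁ := R.unramified₁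
  unramified₂ := R.unramified₂
  complete := R.complete
  traces := R.traces

/-- **Route T constructor** (image `S₅(b)`; levels `277`, `349`). [cite: BrumerEtAl2019, §7.1 p. 1187 and Lemma 5.1.5 p. 1174] -/
theorem ConjCertificate.ofTransvection (R : ConjCertificate.Rest S P ν ρ₁ ρ₂)
    (hker : ∀ γ, residual ρ₁.toMonoidHom γ = 1 ↔ residual ρ₂.toMonoidHom γ = 1)
    {c : absoluteGaloisGroup K} (hc5 : residual ρ₁.toMonoidHom c ^ 5 = 1)
    (hc1 : residual ρ₁.toMonoidHom c ≠ 1) {i : absoluteGaloisGroup K}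
    (hi₁ : IsTransvection ((residual ρ₁.toMonoidHom i : GL (Fin 4) (ZMod 2)) :
      Matrix (Fin 4) (Fin 4) (ZMod 2)))
    (hi₂ : IsTransvection ((residual ρ₂.toMonoidHom i : GL (Fin 4) (ZMod 2)) :
      Matrix (Fin 4) (Fin 4) (ZMod 2))) :
    ConjCertificate S P ν ρ₁ ρ₂ :=
  ConjCertificate.ofRest R (ConjCertificate.residual_conj_of_transvection ρ₁ ρ₂ ν ν R.similitude₁
    R.similitude₂ hker hc5 hc1 hi₁ hi₂)

/-- **Image-`S₆` constructor** (level `587`). [cite: BrumerEtAl2019, §7.3 p. 1191 and (5.1.8) p. 1174] -/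
theorem ConjCertificate.ofTraceOrderThree (R : ConjCertificate.Rest S P ν ρ₁ ρ₂)
    (h₁ : (residual ρ₁.toMonoidHom).range = iotaGL.range)
    (hker : ∀ γ, residual ρ₁.toMonoidHom γ = 1 ↔ residual ρ₂.toMonoidHom γ = 1)
    {u : absoluteGaloisGroup K} (hu3 : residual ρ₁.toMonoidHom u ^ 3 = 1)
    (hu1 : residual ρ₁.toMonoidHom u ≠ 1)
    (htr : Matrix.trace ((residual ρ₁.toMonoidHom u : GL (Fin 4) (ZMod 2)) :
        Matrix (Fin 4) (Fin 4) (ZMod 2)) =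
      Matrix.trace ((residual ρ₂.toMonoidHom u : GL (Fin 4) (ZMod 2)) :
        Matrix (Fin 4) (Fin 4) (ZMod 2))) :
    ConjCertificate S P ν ρ₁ ρ₂ :=
  ConjCertificate.ofRest R (ConjCertificate.residual_conj_of_trace_orderThree ρ₁ ρ₂ ν h₁
    R.similitude₂ hker hu3 hu1 htr)

/-- **Image-`S₃ ≀ S₂` constructor** (level `353`). [cite: BrumerEtAl2019, §7.2 p. 1190 and (5.1.8) p. 1174] -/
theorem ConjCertificate.ofRangeS3wrS2 (R : ConjCertificate.Rest S P ν ρ₁ ρ₂)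
    (h₁ : ∃ g₁ : Perm (Fin 6), (residual ρ₁.toMonoidHom).range =
      ((Subgroup.closure (Set.range gensS3wrS2)).map (MulAut.conj g₁).toMonoidHom).map iotaGL)
    (hker : ∀ γ, residual ρ₁.toMonoidHom γ = 1 ↔ residual ρ₂.toMonoidHom γ = 1)
    {u : absoluteGaloisGroup K} (hu6 : residual ρ₁.toMonoidHom u ^ 6 = 1)
    (hu2 : residual ρ₁.toMonoidHom u ^ 2 ≠ 1)
    (htr : Matrix.trace ((residual ρ₁.toMonoidHom u : GL (Fin 4) (ZMod 2)) :
        Matrix (Fin 4) (Fin 4) (ZMod 2)) =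
      Matrix.trace ((residual ρ₂.toMonoidHom u : GL (Fin 4) (ZMod 2)) :
        Matrix (Fin 4) (Fin 4) (ZMod 2))) :
    ConjCertificate S P ν ρ₁ ρ₂ :=
  ConjCertificate.ofRest R (ConjCertificate.residual_conj_of_range_S3wrS2 ρ₁ ρ₂ ν h₁
    R.similitude₂ hker hu6 hu2 htr)

/-- **Image-`S₆` constructor, surjectivity from the count `#im ρ̄₁ = 720`.** [cite: BrumerEtAl2019, §7.3 p. 1191 and (5.1.8) p. 1174] -/
theorem ConjCertificate.ofTraceOrderThree' (R : ConjCertificate.Rest S P ν ρ₁ ρ₂)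
    (h720 : Nat.card (residual ρ₁.toMonoidHom).range = 720)
    (hker : ∀ γ, residual ρ₁.toMonoidHom γ = 1 ↔ residual ρ₂.toMonoidHom γ = 1)
    {u : absoluteGaloisGroup K} (hu3 : residual ρ₁.toMonoidHom u ^ 3 = 1)
    (hu1 : residual ρ₁.toMonoidHom u ≠ 1)
    (htr : Matrix.trace ((residual ρ₁.toMonoidHom u : GL (Fin 4) (ZMod 2)) :
        Matrix (Fin 4) (Fin 4) (ZMod 2)) =
      Matrix.trace ((residual ρ₂.toMonoidHom u : GL (Fin 4) (ZMod 2)) :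
        Matrix (Fin 4) (Fin 4) (ZMod 2))) :
    ConjCertificate S P ν ρ₁ ρ₂ :=
  ConjCertificate.ofTraceOrderThree R
    (GSp4F2.residual_range_eq_iotaGL_of_card ρ₁ ν R.similitude₁ h720) hker hu3 hu1 htr

/-- **Transfer of a certificate up to frame along a residual conjugacy `ρ̄₁' = ι(π) ρ̄₁ ι(π)⁻¹`.**  A
`ConjCertificate` for `(ρ₁, ρ₂)`, a permutation `π` conjugating `ρ̄₁` to `ρ̄₁'` (two surfaces with the same
`2`-division field: `π` is produced by `GSp4F2.exists_conj_of_ker_iff_of_trace_orderThree` etc. applied to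
`(ρ̄₁, ρ̄₁')`), Step 1 up to frame and Step 5 and the side conditions for `(ρ₁', ρ₂')` give a
`ConjCertificate` for `(ρ₁', ρ₂')` with the SAME `S`, `P` — Steps 2–4 and absolute irreducibility
transported by `complete_of_conj` / `IsAbsIrreducible.of_conj`. [cite: BrumerEtAl2019, Alg 2.4.1 p. 1156; Thm 7.3.1 and §7.3 p. 1191] -/
theorem ConjCertificate.ofResidualConj (C : ConjCertificate S P ν ρ₁ ρ₂)
    {ρ₁' ρ₂' : FramedGaloisRep K ℤ_[2] 4} (π : Perm (Fin 6))
    (h₁ : ∀ σ, residual ρ₁'.toMonoidHom σ =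
      iotaGL π * residual ρ₁.toMonoidHom σ * (iotaGL π)⁻¹)
    (h₂ : ∃ π' : Perm (Fin 6), ∀ σ, residual ρ₂'.toMonoidHom σ =
      iotaGL π' * residual ρ₁'.toMonoidHom σ * (iotaGL π')⁻¹)
    (hs₁ : ∀ σ, IsSimilitude (antiIdAlt4 ℤ_[2]) (ν σ)
      ((ρ₁' σ : GL (Fin 4) ℤ_[2]) : Matrix (Fin 4) (Fin 4) ℤ_[2]))
    (hs₂ : ∀ σ, IsSimilitude (antiIdAlt4 ℤ_[2]) (ν σ)
      ((ρ₂' σ : GL (Fin 4) ℤ_[2]) : Matrix (Fin 4) (Fin 4) ℤ_[2]))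
    (hu₁ : ∀ v ∉ S, ρ₁'.IsUnramifiedAt v) (hu₂ : ∀ v ∉ S, ρ₂'.IsUnramifiedAt v)
    (ht : ∀ σ ∈ frobeniusAt K P, FramedRep.trace ρ₁' σ = FramedRep.trace ρ₂' σ) :
    ConjCertificate S P ν ρ₁' ρ₂' where
  similitude₁ := hs₁
  similitude₂ := hs₂
  residual_conj := h₂
  absIrreducible := IsAbsIrreducible.of_conj _ _ (iotaGL π) h₁ C.absIrreducible
  unramified₁ := hu₁
  unramified₂ := hu₂
  complete := by
    have hg : ((iotaGL π : GL (Fin 4) (ZMod 2)) : Matrix (Fin 4) (Fin 4) (ZMod 2))ᵀ *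
        (antiIdAlt4 ℤ_[2]).map (PadicInt.toZMod (p := 2)) * (iotaGL π : GL (Fin 4) (ZMod 2)) =
        (antiIdAlt4 ℤ_[2]).map (PadicInt.toZMod (p := 2)) := by
      rw [antiIdAlt4_map_toZMod]
      exact (mem_range_iotaGL _).1 (MonoidHom.mem_range.2 ⟨π, rfl⟩)
    exact complete_of_conj _ _ _ (iotaGL π) hg h₁ _ _ C.complete
  traces := ht

/-- Surface form (`K = ℚ`, level `N`, check primes `T`) of `ConjCertificate.ofResidualConj`. [cite: BrumerEtAl2019, Thm 7.3.1 and §7.3 p. 1191] -/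
theorem SurfaceConjCertificate.ofResidualConj {N : ℕ} {T : Finset ℕ}
    {ν : absoluteGaloisGroup ℚ → ℤ_[2]} {ρA ρf ρA' ρf' : FramedGaloisRep ℚ ℤ_[2] 4}
    (C : SurfaceConjCertificate N T ν ρA ρf) (π : Perm (Fin 6))
    (h₁ : ∀ σ, residual ρA'.toMonoidHom σ =
      iotaGL π * residual ρA.toMonoidHom σ * (iotaGL π)⁻¹)
    (h₂ : ∃ π' : Perm (Fin 6), ∀ σ, residual ρf'.toMonoidHom σ =
      iotaGL π' * residual ρA'.toMonoidHom σ * (iotaGL π')⁻¹)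
    (hs₁ : ∀ σ, IsSimilitude (antiIdAlt4 ℤ_[2]) (ν σ)
      ((ρA' σ : GL (Fin 4) ℤ_[2]) : Matrix (Fin 4) (Fin 4) ℤ_[2]))
    (hs₂ : ∀ σ, IsSimilitude (antiIdAlt4 ℤ_[2]) (ν σ)
      ((ρf' σ : GL (Fin 4) ℤ_[2]) : Matrix (Fin 4) (Fin 4) ℤ_[2]))
    (hu₁ : ∀ v ∉ placesOver (badPrimes N), ρA'.IsUnramifiedAt v)
    (hu₂ : ∀ v ∉ placesOver (badPrimes N), ρf'.IsUnramifiedAt v)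
    (ht : ∀ σ ∈ frobeniusAt ℚ (placesOver T), FramedRep.trace ρA' σ = FramedRep.trace ρf' σ) :
    SurfaceConjCertificate N T ν ρA' ρf' :=
  ConjCertificate.ofResidualConj C π h₁ h₂ hs₁ hs₂ hu₁ hu₂ ht

end Constructors

end Literature.NumberTheory.FaltingsSerre

end
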